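import Literature.MathematicalPhysics.QuantumFieldTheory.Balaban1983to89.Beta.OneStepResolventKernel

/-!
# GAN24 / WoodburyFibreBlocks — the BLOCK SPLIT of a packed `(field ⊕ multiplier)` kernel and the additivity of `Decays` over it
# (exit R8 (i) «split sockets» of `HOME/b2b-balaban-gan24-p3/WOODBURY-FIBRE.md`, executed; part 1 of `GAN24/WoodburyFibre`)

Cell `pub-balaban`, β sub-cell, BINDER ROW **G-an2-4 ∕ (CONV-C)** (NOT IN PRINT), prover part **P3 = WOODBURY-FIBRE reduction** (unit
`b2b-balaban-gan24-p3`, gen 2).  HONEST FRAMING (verbatim): discharging `BetaPertH` makes Bałaban's UV stability UNCONDITIONAL — a real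
constructive-QFT result; it is NOT the continuum limit and NOT the Clay problem.  HONEST DEPENDENCY: continuum YM on T⁴ ⇐ BetaPertH ∧ nine
spine estimates (0/9 proved); BetaPertH ⇐ (D1) ∧ (D4) ∧ CAP+tail; G-an2-4 gates asym, D1 and NE2/3/4.  ABSOLUTE RULE honoured: `[folklore]`
bookkeeping on an2's packed kernels `MKer (d+1) (Fib d)` (`OneStepResolventKernel`); no `Prop`, no cite, nothing instantiated.

CONTENT: `blockFF ∕ blockFM ∕ blockMF ∕ blockMM K` (one block kept, the rest zero), `blockF := FF + FM + MF`, `blocks_sum`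
(`FF + FM + MF + MM = K`), the blocks commute with differences (`block*_sub`), `decays_add`, and the SPLIT SOCKETS `decays_of_blockF_blockMM`,
`decays_of_blocks`: `Decays` of the blocks ⇒ `Decays` of the kernel (constants add, rate common).  Consumer: the wall's resolvent rows
(`PropagatorWoodburyFibreTarget.ConvCResolvent`) can be fed block by block; part 2 (`GAN24/WoodburyFibre`) supplies the multiplier block from
the tree's `Δ_k`-rate.  NOT BetaPertH, NOT continuum, NOT Clay.
-/

noncomputable section

open Literature.MathematicalPhysics.QuantumFieldTheory.Balaban1983to89
open Literature.MathematicalPhysics.QuantumFieldTheory.Balaban1983to89.Beta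
open ExpKernelCalculus (MKer Decays)
open OneStepResolventKernel (Fib)
open B12Sec2to5 (l1)

namespace Summit.QuantumFields.BalabanUV.Beta.GAN24.WoodburyFibreBlocks

/-! ## §1 The block split of a packed kernel (exit R8 (i): split sockets) -/

section Blocks

variable {d : ℕ}

/-- The field–field block of a packed kernel (all other entries zero). [folklore] -/
def blockFF (K : MKer (d + 1) (Fib d)) : MKer (d + 1) (Fib d) := fun x y a b =>
  match a, b with
  | Sum.inl _, Sum.inl _ => K x y a b
  | _, _ => 0

/-- The field–multiplier block. [folklore] -/
def blockFM (K : MKer (d + 1) (Fib d)) : MKer (d + 1) (Fib d) := fun x y a b =>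
  match a, b with
  | Sum.inl _, Sum.inr _ => K x y a b
  | _, _ => 0

/-- The multiplier–field block. [folklore] -/
def blockMF (K : MKer (d + 1) (Fib d)) : MKer (d + 1) (Fib d) := fun x y a b =>
  match a, b with
  | Sum.inr _, Sum.inl _ => K x y a b
  | _, _ => 0

/-- The multiplier–multiplier block. [folklore] -/
def blockMM (K : MKer (d + 1) (Fib d)) : MKer (d + 1) (Fib d) := fun x y a b =>
  match a, b with
  | Sum.inr _, Sum.inr _ => K x y a b
  | _, _ => 0

/-- The four blocks reassemble the kernel. [folklore] -/
theorem blocks_sum (K : MKer (d + 1) (Fib d)) : blockFF K + blockFM K + blockMF K + blockMM K = K := by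
  funext x y a b
  rcases a with κ | κ <;> rcases b with l | l <;> simp [blockFF, blockFM, blockMF, blockMM]

/-- `blockFF` commutes with differences. [folklore] -/
theorem blockFF_sub (K K' : MKer (d + 1) (Fib d)) : blockFF (K - K') = blockFF K - blockFF K' := by
  funext x y a b; rcases a with κ | κ <;> rcases b with l | l <;> simp [blockFF]

/-- `blockFM` commutes with differences. [folklore] -/
theorem blockFM_sub (K K' : MKer (d + 1) (Fib d)) : blockFM (K - K') = blockFM K - blockFM K' := by
  funext x y a b; rcases a with κ | κ <;> rcases b with l | l <;> simp [blockFM]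

/-- `blockMF` commutes with differences. [folklore] -/
theorem blockMF_sub (K K' : MKer (d + 1) (Fib d)) : blockMF (K - K') = blockMF K - blockMF K' := by
  funext x y a b; rcases a with κ | κ <;> rcases b with l | l <;> simp [blockMF]

/-- `blockMM` commutes with differences. [folklore] -/
theorem blockMM_sub (K K' : MKer (d + 1) (Fib d)) : blockMM (K - K') = blockMM K - blockMM K' := by
  funext x y a b; rcases a with κ | κ <;> rcases b with l | l <;> simp [blockMM]

/-- The three FIELD blocks together (all entries with at least one field leg). [folklore] -/
def blockF (K : MKer (d + 1) (Fib d)) : MKer (d + 1) (Fib d) := blockFF K + blockFM K + blockMF K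

/-- `blockF` commutes with differences. [folklore] -/
theorem blockF_sub (K K' : MKer (d + 1) (Fib d)) : blockF (K - K') = blockF K - blockF K' := by
  simp only [blockF, blockFF_sub, blockFM_sub, blockMF_sub]
  abel

/-- `K = blockF K + blockMM K`. [folklore] -/
theorem blockF_add_blockMM (K : MKer (d + 1) (Fib d)) : blockF K + blockMM K = K := blocks_sum K

/-- `Decays` is additive in the kernel (constants add). [folklore] -/
theorem decays_add {F : Type*} {A B : MKer (d + 1) F} {C C' δ : ℝ} (hA : Decays A C δ) (hB : Decays B C' δ) :
    Decays (A + B) (C + C') δ := by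
  intro x y a b
  have h1 := hA x y a b
  have h2 := hB x y a b
  calc |(A + B) x y a b| = |A x y a b + B x y a b| := rfl
    _ ≤ |A x y a b| + |B x y a b| := abs_add_le _ _
    _ ≤ C * Real.exp (-δ * l1 (x - y)) + C' * Real.exp (-δ * l1 (x - y)) := add_le_add h1 h2
    _ = (C + C') * Real.exp (-δ * l1 (x - y)) := by ring

/-- **SPLIT SOCKETS**: `Decays` of the field blocks and of the multiplier block give `Decays` of the kernel. [folklore] -/
theorem decays_of_blockF_blockMM {K : MKer (d + 1) (Fib d)} {C₁ C₂ δ : ℝ} (hF : Decays (blockF K) C₁ δ)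
    (hM : Decays (blockMM K) C₂ δ) : Decays K (C₁ + C₂) δ := by
  have h := decays_add hF hM
  rwa [blockF_add_blockMM] at h

/-- The four-block version. [folklore] -/
theorem decays_of_blocks {K : MKer (d + 1) (Fib d)} {C₁ C₂ C₃ C₄ δ : ℝ} (h₁ : Decays (blockFF K) C₁ δ)
    (h₂ : Decays (blockFM K) C₂ δ) (h₃ : Decays (blockMF K) C₃ δ) (h₄ : Decays (blockMM K) C₄ δ) :
    Decays K (C₁ + C₂ + C₃ + C₄) δ := by
  have h := decays_add (decays_add (decays_add h₁ h₂) h₃) h₄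
  rwa [blocks_sum] at h

end Blocks

end Summit.QuantumFields.BalabanUV.Beta.GAN24.WoodburyFibreBlocks

end
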